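import Summits.CriticalPhenomena.Ising3DConformalLimit.Theorems.SynchronousCouplingRotationJoiningIsotropyMoments
import Summits.CriticalPhenomena.Ising3DConformalLimit.Theorems.SynchronousCouplingRotationJoiningIsotropyConstrainedMoment
import Summits.CriticalPhenomena.Ising3DConformalLimit.Theorems.SynchronousCouplingRotationJoiningTiltedTransferTools
import Summits.CriticalPhenomena.Ising3DConformalLimit.Theorems.SynchronousCouplingRotationJoiningTwoPointToolkit
import Summits.CriticalPhenomena.Ising3DConformalLimit.Theorems.SynchronousCouplingRotationJoiningRateBootstrap
import Summits.CriticalPhenomena.Ising3DConformalLimit.Theorems.EnergyNotSigmaSquaredMoebiusLimitExistsPinnedTwoPoint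
import HarnessLib

/-!
# Route `SynchronousCoupling`, crux `RotationJoining` (stmt-CriticalPhenomena-18763), line `SketchIdeator2` (reshape 2) —
# tools for the final assembly of `stub_isotropyTransfer` (lead's stub F)

Inputs of the method-of-moments transfer that do not depend on the smeared-difference theorem (A1):
* lattice bookkeeping: every axis cell is a translate of the `u = 0` one (`pairSum_axisCell : Σ_{x,y ∈ axisCell n u} ⟨σσ⟩ =
  V(n)`), positivity of the tilted normalising pair sum, the smeared two-point correlator as a pair sum, flattening of
  mixed powers `∏ᵢ bᵢ^{eᵢ} = ∏_{l < Σeᵢ} b_{g(l)}`;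
* moment bounds from Newman's Gaussian inequality: `E[(aB)^{2k}] ≤ (Rk)ᵏ` when `a²E[B²] ≤ R`
  (`integral_pow_const_mul_blockSum_le`, with `(2k)!/(2ᵏk!) ≤ kᵏ`), and the AM–GM bound
  `E[∏_{l<2q} B(Pₗ)] ≤ (2q)!/(2^q q!) W^q` (`integral_prod_blockSum_le`);
* the scale factor `c_n = ρ_pin(1/n)/n³`: `c_n² V(n) → Φ⁻¹ > 0` from `TwoPointScaling` (i) of the funnel
  (`tendsto_scale_sq_mul_blockCov`);
* the abstract real-analysis endgame `tendsto_sub_of_scaled` (registered sub-goal).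
References: C. M. Newman, Comm. Math. Phys. 41 (1975) 1–9 (Gaussian-type moment inequalities under Lee–Yang); P. Billingsley, *Probability and Measure*, §30.
No definitions, no sorry.
-/

noncomputable section

namespace Summit.CriticalPhenomena.Ising3DConformalLimit.Cruxes.RotationJoining.RateSplitting

open MeasureTheory Filter Literature.Probability.LatticeModels Finset
open scoped BigOperators Topology
open Summit.CriticalPhenomena.Ising3DConformalLimit.MoebiusLimitExistsOnlyInteraction (rhoPin rhoPin_sq)
open Summit.CriticalPhenomena.Ising3DConformalLimit.Cruxes.ExistsScaleCovariantLimit.MonotoneBlockingPort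
  (blockCov blockCov_zero_pos BlockTwoLimits stub_twoPointScaling_of_lattice stub_blockCovAlgebra
    stub_blockCovTwoPointBounds)
open Summit.CriticalPhenomena.Ising3DConformalLimit.Theses

/-! ### Lattice bookkeeping -/

/-- Every axis cell is a lattice translate of the `u = 0` one. [folklore] -/
theorem axisCell_eq_image_add (n : ℕ) (u : Fin 3 → ℤ) :
    axisCell n u = (axisCell n 0).image (· + fun i => (n : ℤ) * u i) := by
  ext x
  simp only [axisCell, Fintype.mem_piFinset, Finset.mem_Ico, Finset.mem_image, Pi.zero_apply, mul_zero,
    zero_add]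
  constructor
  · intro hx
    refine ⟨x - fun i => (n : ℤ) * u i, fun i => ?_, ?_⟩
    · have := hx i
      simp only [Pi.sub_apply]
      constructor <;> linarith [this.1, this.2]
    · funext i
      simp
  · rintro ⟨a, ha, rfl⟩ i
    have := ha i
    simp only [Pi.add_apply]
    constructor <;> linarith [this.1, this.2]

/-- The pair sum of every axis cell is the block variance `V(n)`. [folklore] -/
theorem pairSum_axisCell (n : ℕ) (u : Fin 3 → ℤ) :
    ∑ x ∈ axisCell n u, ∑ y ∈ axisCell n u, criticalTwoPoint 3 (y - x) = blockCov n 0 := by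
  rw [axisCell_eq_image_add, pairSum_image_add, pairSum_axisCell_zero]

/-- The pair sum of the `u = 0` tilted cell of side `n ≥ 1` is positive (it is at least `#cell = n³`). [folklore] -/
theorem pairSum_tiltCell_zero_pos (hTG : TiltGeometry) {n : ℕ} (hn : 1 ≤ n) (m : ℕ) :
    0 < ∑ x ∈ tiltCell n m 0, ∑ y ∈ tiltCell n m 0, criticalTwoPoint 3 (y - x) := by
  have h5 := hTG.2.2.2.2.1
  have h0m : ∀ i, |(0 : Fin 3 → ℤ) i| ≤ (m : ℤ) := fun i => by simp
  have key := card_le_pairSum (tiltCell n m 0)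
  rw [h5 n m 0 h0m] at key
  push_cast at key
  exact lt_of_lt_of_le (by positivity) key

/-- The smeared two-point correlator over `S × S` is the pair sum of `S`. [folklore] -/
theorem sum_piFinset_two_eq_pairSum {μ : Measure (SpinConfig (Site 3))} [IsFiniteMeasure μ]
    (hcorr : ∀ A : Finset (Site 3), spinCorr μ A = plusCorr 3 (criticalBeta 3) 0 A) (S : Finset (Site 3)) :
    ∑ y ∈ Fintype.piFinset (fun _ : Fin 2 => S), criticalCorr 3 2 y =
      ∑ x ∈ S, ∑ y ∈ S, criticalTwoPoint 3 (y - x) := by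
  rw [← integral_prod_blockSum_eq_sum hcorr (fun _ : Fin 2 => S), ← integral_blockSum_sq hcorr S]
  refine integral_congr_ae (Eventually.of_forall fun σ => ?_)
  simp [sq]

/-- Flattening mixed powers: `∏ᵢ bᵢ^{eᵢ} = ∏_{l < Σᵢ eᵢ} b_{g(l)}`, `g(l) = (finSigmaFinEquiv⁻¹ l).1`. [folklore] -/
theorem prod_pow_eq_prod_flatten {j : ℕ} (e : Fin j → ℕ) (b : Fin j → ℝ) :
    ∏ i, b i ^ e i = ∏ l : Fin (∑ i, e i), b ((finSigmaFinEquiv (n := e)).symm l).1 := by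
  have h1 : ∏ i, b i ^ e i = ∏ p : (Σ i : Fin j, Fin (e i)), b p.1 := by
    rw [Fintype.prod_sigma]
    simp only [Finset.prod_const, Finset.card_univ, Fintype.card_fin]
  rw [h1]
  exact Fintype.prod_equiv (finSigmaFinEquiv (n := e)) _ _ fun p => by simp

/-- `(2k)!/(2ᵏ k!) ≤ kᵏ`. [folklore] -/
theorem factorial_two_mul_div_le (k : ℕ) :
    ((2 * k).factorial : ℝ) / (2 ^ k * k.factorial) ≤ (k : ℝ) ^ k := by
  rw [div_le_iff₀ (by positivity)]
  have h3 : (2 * k).factorial ≤ k.factorial * (2 * k) ^ k := by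
    have h := Nat.factorial_mul_ascFactorial k k
    have h2 := Nat.ascFactorial_le_pow_add k k
    rw [two_mul, ← h]
    exact Nat.mul_le_mul_left _ h2
  calc ((2 * k).factorial : ℝ) ≤ ((k.factorial * (2 * k) ^ k : ℕ) : ℝ) := by exact_mod_cast h3
    _ = (k : ℝ) ^ k * (2 ^ k * k.factorial) := by push_cast; ring

/-! ### Moment bounds from Newman's Gaussian inequality -/

/-- Powers of block sums are integrable against a finite measure. [folklore] -/
theorem integrable_blockSum_pow (μ : Measure (SpinConfig (Site 3))) [IsFiniteMeasure μ] (S : Finset (Site 3))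
    (k : ℕ) : Integrable (fun σ => (blockSum S σ) ^ k) μ :=
  Integrable.of_bound ((measurable_blockSum S).pow_const k).aestronglyMeasurable ((S.card : ℝ) ^ k)
    (Eventually.of_forall fun σ => by
      rw [Real.norm_eq_abs, abs_pow]
      exact pow_le_pow_left₀ (abs_nonneg _) (abs_blockSum_le S σ) k)

/-- Products of block sums are integrable against a finite measure. [folklore] -/
theorem integrable_prod_blockSum (μ : Measure (SpinConfig (Site 3))) [IsFiniteMeasure μ] {k : ℕ}
    (P : Fin k → Finset (Site 3)) : Integrable (fun σ => ∏ l, blockSum (P l) σ) μ := by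
  simp_rw [prod_blockSum_eq_sum_spinMonomial P]
  exact integrable_finsetSum _ fun y _ => integrable_spinMonomial' μ y

/-- **Sub-Gaussian even moments of a normalised block**: if `E[B^{2k}] ≤ (2k)!/(2ᵏk!) E[B²]ᵏ` (Newman) and
`a² E[B²] ≤ R`, then `E[(aB)^{2k}] ≤ (Rk)ᵏ`. [cite: Newman1975, Thm 3] -/
theorem integral_pow_const_mul_blockSum_le {μ : Measure (SpinConfig (Site 3))}
    (hNBμ : ∀ (S : Finset (Site 3)) (j : ℕ), ∫ σ, (blockSum S σ) ^ (2 * j) ∂μ ≤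
      ((2 * j).factorial : ℝ) / (2 ^ j * j.factorial) * (∫ σ, (blockSum S σ) ^ 2 ∂μ) ^ j)
    (a : ℝ) (S : Finset (Site 3)) {R : ℝ} (hR : a ^ 2 * ∫ σ, (blockSum S σ) ^ 2 ∂μ ≤ R) (k : ℕ) :
    ∫ σ, (a * blockSum S σ) ^ (2 * k) ∂μ ≤ (R * k) ^ k := by
  have h1 : ∫ σ, (a * blockSum S σ) ^ (2 * k) ∂μ = a ^ (2 * k) * ∫ σ, (blockSum S σ) ^ (2 * k) ∂μ := by
    simp_rw [mul_pow]
    exact integral_const_mul _ _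
  rw [h1]
  have ha : 0 ≤ a ^ (2 * k) := by rw [pow_mul]; exact pow_nonneg (sq_nonneg a) k
  have hint : 0 ≤ ∫ σ, (blockSum S σ) ^ 2 ∂μ := integral_nonneg fun σ => sq_nonneg _
  have hQ : 0 ≤ a ^ 2 * ∫ σ, (blockSum S σ) ^ 2 ∂μ := mul_nonneg (sq_nonneg a) hint
  calc a ^ (2 * k) * ∫ σ, (blockSum S σ) ^ (2 * k) ∂μ
      ≤ a ^ (2 * k) * (((2 * k).factorial : ℝ) / (2 ^ k * k.factorial) * (∫ σ, (blockSum S σ) ^ 2 ∂μ) ^ k) :=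
        mul_le_mul_of_nonneg_left (hNBμ S k) ha
    _ = ((2 * k).factorial : ℝ) / (2 ^ k * k.factorial) * (a ^ 2 * ∫ σ, (blockSum S σ) ^ 2 ∂μ) ^ k := by
        rw [pow_mul, mul_pow]; ring
    _ ≤ (k : ℝ) ^ k * R ^ k :=
        mul_le_mul (factorial_two_mul_div_le k) (pow_le_pow_left₀ hQ hR k) (pow_nonneg hQ k)
          (pow_nonneg (Nat.cast_nonneg _) k)
    _ = (R * k) ^ k := by rw [mul_pow, mul_comm]

/-- **Smeared moments of even order are controlled by second moments** (AM–GM over the `k = 2q` blocks, then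
Newman's Gaussian bound): `E[∏ₗ B(Pₗ)] ≤ (2q)!/(2^q q!) · W^q` if `E[B(Pₗ)²] ≤ W` for all `l`.
[cite: Newman1975, Thm 3] -/
theorem integral_prod_blockSum_le {μ : Measure (SpinConfig (Site 3))} [IsProbabilityMeasure μ]
    (hNBμ : ∀ (S : Finset (Site 3)) (j : ℕ), ∫ σ, (blockSum S σ) ^ (2 * j) ∂μ ≤
      ((2 * j).factorial : ℝ) / (2 ^ j * j.factorial) * (∫ σ, (blockSum S σ) ^ 2 ∂μ) ^ j)
    {k q : ℕ} (hk : k = 2 * q) (P : Fin k → Finset (Site 3)) {W : ℝ}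
    (hW : ∀ l, ∫ σ, (blockSum (P l) σ) ^ 2 ∂μ ≤ W) :
    ∫ σ, ∏ l, blockSum (P l) σ ∂μ ≤ ((2 * q).factorial : ℝ) / (2 ^ q * q.factorial) * W ^ q := by
  rcases Nat.eq_zero_or_pos q with rfl | hq
  · have hk0 : k = 0 := by omega
    subst hk0
    simp
  have hkpos : 0 < k := by omega
  set Nq : ℝ := ((2 * q).factorial : ℝ) / (2 ^ q * q.factorial) with hNq
  have hmom : ∀ l, ∫ σ, (blockSum (P l) σ) ^ k ∂μ ≤ Nq * W ^ q := by
    intro l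
    rw [hk]
    refine (hNBμ (P l) q).trans ?_
    exact mul_le_mul_of_nonneg_left
      (pow_le_pow_left₀ (integral_nonneg fun σ => sq_nonneg _) (hW l) q) (by positivity)
  have hpt : ∀ σ, ∏ l, blockSum (P l) σ ≤ (∑ l, (blockSum (P l) σ) ^ k) / k := by
    intro σ
    have hcard : (Finset.univ : Finset (Fin k)).card = k := by simp
    have h := prod_le_sum_pow_div (Finset.univ : Finset (Fin k)) (by rw [hcard]; omega)
      (fun l => |blockSum (P l) σ|) (fun l _ => abs_nonneg _)
    rw [hcard] at h
    have heven : Even k := ⟨q, by omega⟩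
    calc ∏ l, blockSum (P l) σ ≤ |∏ l, blockSum (P l) σ| := le_abs_self _
      _ = ∏ l, |blockSum (P l) σ| := Finset.abs_prod _ _
      _ ≤ (∑ l, |blockSum (P l) σ| ^ k) / k := h
      _ = (∑ l, (blockSum (P l) σ) ^ k) / k := by simp_rw [heven.pow_abs]
  calc ∫ σ, ∏ l, blockSum (P l) σ ∂μ ≤ ∫ σ, (∑ l, (blockSum (P l) σ) ^ k) / k ∂μ :=
        integral_mono (integrable_prod_blockSum μ P)
          ((integrable_finsetSum _ fun l _ => integrable_blockSum_pow μ (P l) k).div_const _) hpt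
    _ = (∑ l, ∫ σ, (blockSum (P l) σ) ^ k ∂μ) / k := by
        rw [integral_div, integral_finsetSum _ fun l _ => integrable_blockSum_pow μ (P l) k]
    _ ≤ (∑ _l : Fin k, Nq * W ^ q) / k := by
        gcongr with l
        exact hmom l
    _ = Nq * W ^ q := by
        rw [Finset.sum_const, Finset.card_univ, Fintype.card_fin, nsmul_eq_mul]
        have : (k : ℝ) ≠ 0 := by exact_mod_cast hkpos.ne'
        field_simp

/-! ### The scale factor `c_n = ρ_pin(1/n)/n³` -/

/-- **`c_n² V(n) → Φ⁻¹ > 0`**, `c_n = ρ_pin(1/n)/n³`: `TwoPointScaling` (i) of the funnel (`n⁶ g(n)/V(n) → Φ > 0`)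
and `ρ_pin(1/n)² = g(n)⁻¹`. [folklore] -/
theorem tendsto_scale_sq_mul_blockCov (hDJ : SynchronousCoupling.DilationJoinings)
    (hUR : SynchronousCoupling.UniformRegularity) :
    ∃ sinf : ℝ, 0 < sinf ∧
      Tendsto (fun n : ℕ => (rhoPin (1 / (n : ℝ)) / (n : ℝ) ^ 3) ^ 2 * blockCov n 0) atTop (𝓝 sinf) := by
  have hBL := Cruxes.JoiningsTransfer.Sketch.blockLimits_of_joinings hDJ hUR
  have hBTL : BlockTwoLimits := fun k hk => hBL 2 le_rfl k hk
  obtain ⟨⟨Φ, hΦ, hlim⟩, -⟩ := stub_twoPointScaling_of_lattice stub_blockCovAlgebra stub_blockCovTwoPointBounds hBTL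
  refine ⟨Φ⁻¹, inv_pos.2 hΦ, (hlim.inv₀ hΦ.ne').congr' ?_⟩
  filter_upwards [eventually_ge_atTop 1] with n hn
  have hg : 0 < criticalTwoPoint 3 (Pi.single 0 (n : ℤ)) := criticalTwoPoint_axis_pos n
  have hn0 : (0 : ℝ) < n := by exact_mod_cast hn
  have hV : 0 < blockCov n 0 := blockCov_zero_pos n hn
  rw [div_pow, rhoPin_sq, one_div_one_div, Int.floor_natCast]
  field_simp

/-! ### The analysis endgame -/

/-- **Registered sub-goal `tendsto_sub_of_scaled` — abstract endgame.** If `c² V → s > 0`, `c² W → s`, `(c²)^q (S_T − S_A) → 0` and `(c²)^q S_A` is bounded, then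
`(√W)^{-2q} S_T − (√V)^{-2q} S_A → 0` (the self-normalised even mixed moments agree asymptotically). [folklore] -/
theorem tendsto_sub_of_scaled {c V W SA ST : ℕ → ℝ} {q : ℕ} {sinf : ℝ} (hsinf : 0 < sinf)
    (hs : Tendsto (fun n => c n ^ 2 * V n) atTop (𝓝 sinf))
    (hs' : Tendsto (fun n => c n ^ 2 * W n) atTop (𝓝 sinf))
    (hdiff : Tendsto (fun n => (c n ^ 2) ^ q * ST n - (c n ^ 2) ^ q * SA n) atTop (𝓝 0))
    (hbdd : ∃ B : ℝ, ∀ n, |(c n ^ 2) ^ q * SA n| ≤ B)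
    (hpos : ∀ᶠ n in atTop, 0 < c n ∧ 0 < V n ∧ 0 < W n) :
    Tendsto (fun n => ((Real.sqrt (W n))⁻¹) ^ (2 * q) * ST n - ((Real.sqrt (V n))⁻¹) ^ (2 * q) * SA n)
      atTop (𝓝 0) := by
  obtain ⟨B, hB⟩ := hbdd
  have hsq : sinf ^ q ≠ 0 := pow_ne_zero q hsinf.ne'
  have hT1 : Tendsto (fun n => ((c n ^ 2) ^ q * ST n - (c n ^ 2) ^ q * SA n) / (c n ^ 2 * W n) ^ q)
      atTop (𝓝 0) := by
    have := hdiff.div (hs'.pow q) hsq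
    rwa [zero_div] at this
  have hT2 : Tendsto (fun n => (c n ^ 2) ^ q * SA n * (((c n ^ 2 * W n) ^ q)⁻¹ - ((c n ^ 2 * V n) ^ q)⁻¹))
      atTop (𝓝 0) := by
    refine bdd_le_mul_tendsto_zero' B (Eventually.of_forall hB) ?_
    have := ((hs'.pow q).inv₀ hsq).sub ((hs.pow q).inv₀ hsq)
    rwa [sub_self] at this
  have hsum := hT1.add hT2
  rw [add_zero] at hsum
  refine hsum.congr' ?_
  filter_upwards [hpos] with n hn
  obtain ⟨hc, hV, hW⟩ := hn
  have e1 : ((Real.sqrt (W n))⁻¹) ^ (2 * q) = (W n ^ q)⁻¹ := by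
    rw [pow_mul, inv_pow, Real.sq_sqrt hW.le, inv_pow]
  have e2 : ((Real.sqrt (V n))⁻¹) ^ (2 * q) = (V n ^ q)⁻¹ := by
    rw [pow_mul, inv_pow, Real.sq_sqrt hV.le, inv_pow]
  rw [e1, e2, mul_pow, mul_pow]
  have hc1 : c n ≠ 0 := hc.ne'
  have hW1 : W n ≠ 0 := hW.ne'
  have hV1 : V n ≠ 0 := hV.ne'
  have hc2 : (c n ^ 2) ^ q ≠ 0 := pow_ne_zero q (pow_ne_zero 2 hc.ne')
  have hWq : W n ^ q ≠ 0 := pow_ne_zero q hW.ne'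
  have hVq : V n ^ q ≠ 0 := pow_ne_zero q hV.ne'
  field_simp
  ring

end Summit.CriticalPhenomena.Ising3DConformalLimit.Cruxes.RotationJoining.RateSplitting

end
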